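import Summits.ResolutionOfSingularities.ResolutionOfSingularities.Theses.TeissierJung
import Literature.AlgebraicGeometry.Resolution.TeissierPresentation

/-!
# `TeissierReduction` (crux stmt-ResolutionOfSingularities-17085, route `TeissierJung`):
# over `𝔽₂` every Teissier quotient has an `𝔽₂`-point, so closed points of a Teissier-presented
# scheme over `𝔽₂` are `𝔽₂`-rational (negative-side support, refuter crux-disprover seat, gen 2;
# the algebraic half of `Negative/FalseOverPerfectField.lean`; this file does NOT refute the crux)

The predicate `TF X'` of the crux presents every analytic branch `𝒪̂_{X',x} ⧸ P` at every closed
point `x` as a Teissier quotient `k⟦x₁..x_d⟧[u₀..u_{g-1}] ⧸ (E₀, …, E_{g-1})` (Mourtada–Schober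
2025 §3; `Teissier.IsDatum`, `Teissier.ideal` of `Literature/.../TeissierPresentation`), with
coefficients `c_i ∈ k` and a PRIME binomial ideal. Over `k = 𝔽₂` this forces an `𝔽₂`-point:

* `exists_ringHom_of_isDatum` — the augmentation `x_j ↦ 0, u_i ↦ 0` kills every equation `E_i`
  unless some binomial has `A_i = 0` and `μ_i = 0`; then homogeneity gives `v_i = 0`, the strict
  increase of the weights makes `i` the first variable, `c_i = 1` (`𝔽₂ˣ = {1}`), and the binomial
  `u_i^{n_i} − 1 = (u_i − 1)(1 + ⋯ + u_i^{n_i−1})`, `n_i ≥ 2`, lies in the prime binomial ideal;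
  the evaluation `x ↦ 0, u_m ↦ 0 (m ≠ i), u_i ↦ Y` into `𝔽₂[Y] ⧸ (Y^{n_i} − 1)` kills the whole
  binomial ideal (every other binomial has positive weight, hence involves a killed variable) but
  neither factor (degrees `< n_i`) — contradiction. Overweight tails have no constant term.
* `exists_ringHom_stalk_of_teissierPresented` — so at a closed point `x` of a Teissier-presented
  `X'` over `𝔽₂` there is a ring map `𝒪_{X',x} → 𝒪̂_{X',x} → 𝒪̂ ⧸ P → 𝔽₂` (a minimal prime `P`
  of the completion exists, the completion surjecting onto the residue field).
* `false_of_ringHom_zmod2`, `exists_closed_point_of_isIso_restrict` — the two small facts the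
  geometric half uses: a ring containing `w` with `w`, `w − 1` units has no map to `𝔽₂`; over an
  open where `ρ : X' → P` is an isomorphism, closed points and such unit pairs lift to `X'`.

(Over `𝔽₃` the binomial `u² − 2` is prime and `𝔽₉`-points are presentable with `v₀ = 0`: the
obstruction is specific to `𝔽₂`, which is all a counterexample needs.)
-/

noncomputable section

set_option linter.dupNamespace false

namespace Summit.ResolutionOfSingularities.ResolutionOfSingularities.Theorems.TeissierReduction.Negative

open CategoryTheory AlgebraicGeometry IsLocalRing Topology MvPolynomial
open Literature.AlgebraicGeometry.Resolution

universe u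

variable {d g : ℕ}

/-! ## §1 Algebra: over `𝔽₂` every Teissier quotient has an `𝔽₂`-point -/

/-- Splitting one variable off a monic monomial. [folklore] -/
theorem monomial_one_eq_X_pow_mul {σ R : Type*} [CommSemiring R] [DecidableEq σ]
    (e : σ →₀ ℕ) (s : σ) :
    (monomial e (1 : R) : MvPolynomial σ R) =
      X s ^ (e s) * monomial (e - Finsupp.single s (e s)) 1 := by
  rw [X_pow_eq_monomial, monomial_mul, one_mul, add_tsub_cancel_of_le]
  exact Finsupp.single_le_iff.2 le_rfl

/-- **Over `𝔽₂` every Teissier quotient has an `𝔽₂`-point**: for a Teissier datum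
`(n, v, c, A, μ, h)` over `𝔽₂⟦x₁..x_d⟧` (`Teissier.IsDatum`), the augmentation `x_j ↦ 0`,
`u_i ↦ 0` factors through `𝔽₂⟦x⟧[u₀..u_{g-1}] ⧸ (E₀, …, E_{g-1})`. The case of a binomial with
`A_i = 0`, `μ_i = 0` (the only one the augmentation does not kill) is excluded by the primality of
the binomial ideal: then `v_i = 0`, `i` is the first variable, and `u_i^{n_i} − 1`, `n_i ≥ 2`,
factors. [folklore] -/
theorem exists_ringHom_of_isDatum
    {n : Fin g → ℕ} {v : Fin g → (Fin d → ℚ)} {c : Fin g → ZMod 2} {A : Fin g → (Fin d →₀ ℕ)}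
    {mu : Fin g → (Fin g →₀ ℕ)}
    {h : Fin g → MvPolynomial (Fin g) (MvPowerSeries (Fin d) (ZMod 2))}
    (hD : Teissier.IsDatum n v c A mu h) :
    Nonempty ((MvPolynomial (Fin g) (MvPowerSeries (Fin d) (ZMod 2)) ⧸ Teissier.ideal n c A mu h)
      →+* ZMod 2) := by
  classical
  -- positivity of the weights `n_i v_i`
  have hv0 : ∀ i, (0 : Fin d → ℚ) ≤ n i • v i := fun i j => by
    simpa [Pi.smul_apply, nsmul_eq_mul] using
      mul_nonneg (Nat.cast_nonneg (n i)) (hD.weight_nonneg i j)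
  -- a variable of weight zero is the first one
  have hfirst : ∀ l : Fin g, v l = 0 → l.val = 0 := by
    intro l hl
    by_contra hne
    obtain ⟨l', hl'⟩ : ∃ l' : ℕ, l.val = l' + 1 := ⟨l.val - 1, by omega⟩
    have hlt : l' + 1 < g := hl' ▸ l.isLt
    have hl'' : (⟨l' + 1, hlt⟩ : Fin g) = l := Fin.ext hl'.symm
    obtain ⟨hle, hne'⟩ := hD.weight_lt ⟨l', by omega⟩ hlt
    rw [hl'', hl] at hle hne'
    exact hne' (le_antisymm hle (hv0 _))
  have hw00 : Teissier.weight v 0 0 = 0 := by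
    funext j; simp [Teissier.weight]
  -- the augmentation
  let ev : MvPolynomial (Fin g) (MvPowerSeries (Fin d) (ZMod 2)) →+* ZMod 2 :=
    (MvPowerSeries.constantCoeff).comp MvPolynomial.constantCoeff
  have hev_apply : ∀ p, ev p = MvPowerSeries.coeff 0 (p.coeff 0) := fun p => rfl
  -- the overweight tails vanish under the augmentation
  have hh : ∀ i, ev (h i) = 0 := by
    intro i
    rw [hev_apply]
    by_contra hne
    have hsupp : (0 : Fin g →₀ ℕ) ∈ (h i).support := by
      rw [MvPolynomial.mem_support_iff]
      intro h0
      apply hne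
      rw [h0, map_zero]
    obtain ⟨-, hw⟩ := hD.overweight i 0 hsupp
    obtain ⟨hle, hne'⟩ := hw 0 hne
    rw [hw00] at hle hne'
    exact hne' (le_antisymm hle (hv0 i))
  -- the augmentation of the core polynomial
  have hcore : ∀ i, ev (Teissier.core n c A mu h i) =
      -(if A i = 0 ∧ mu i = 0 then c i else 0) := by
    intro i
    have hn : n i ≠ 0 := by have := hD.two_le i; omega
    simp only [Teissier.core, map_add, map_sub, map_mul, map_pow, hh, add_zero]
    rw [hev_apply, hev_apply, hev_apply]
    simp only [MvPolynomial.coeff_X, MvPolynomial.coeff_C, MvPolynomial.coeff_monomial,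
      if_true]
    rw [MvPowerSeries.coeff_monomial]
    by_cases hA : A i = 0 <;> by_cases hmu : mu i = 0 <;>
      simp [hA, hmu, hn, eq_comm, Finsupp.single_eq_zero]
  by_cases hcase : ∃ i, A i = 0 ∧ mu i = 0
  · -- Case 2: a weight-zero binomial `u_i^{n_i} - 1` contradicts primality
    exfalso
    obtain ⟨i, hAi, hmui⟩ := hcase
    have hvi : v i = 0 := by
      have hhom := hD.homogeneous i
      rw [hAi, hmui, hw00] at hhom
      have hn : (n i : ℚ) ≠ 0 := by
        have := hD.two_le i; exact_mod_cast (show n i ≠ 0 by omega)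
      funext j
      have := congrFun hhom j
      simp only [Pi.smul_apply, nsmul_eq_mul, Pi.zero_apply, mul_eq_zero] at this
      rcases this with h1 | h1
      · exact absurd h1 hn
      · exact h1
    have hi0 : i.val = 0 := hfirst i hvi
    have hci : c i = 1 := by
      have h0 := hD.coeff_ne_zero i
      generalize c i = a at h0 ⊢
      revert a; decide
    have hBi : Teissier.binomial n c A mu i = X (Sum.inr i) ^ n i - 1 := by
      simp only [Teissier.binomial, hAi, hmui, hci, map_one, one_mul]
      congr 1
      have : ((0 : Fin d →₀ ℕ).sumElim (0 : Fin g →₀ ℕ)) = 0 := by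
        ext s; cases s <;> simp
      rw [this]
      rfl
    -- the test ring `𝔽₂[Y] ⧸ (Y^{n_i} - 1)` and the evaluation `x ↦ 0`, `u_i ↦ Y`, `u_m ↦ 0`
    set N := n i with hN
    have hN2 : 2 ≤ N := hD.two_le i
    let F : Polynomial (ZMod 2) := Polynomial.X ^ N - Polynomial.C 1
    let T := AdjoinRoot F
    let θ : MvPolynomial (Fin d ⊕ Fin g) (ZMod 2) →+* T :=
      MvPolynomial.eval₂Hom (algebraMap (ZMod 2) T)
        (Sum.elim (fun _ => 0) (fun m => if m = i then AdjoinRoot.root F else 0))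
    have hθx : ∀ j, θ (X (Sum.inl j)) = 0 := fun j => by simp [θ]
    have hθu : ∀ m, m ≠ i → θ (X (Sum.inr m)) = 0 := fun m hm => by simp [θ, hm]
    have hθi : θ (X (Sum.inr i)) = AdjoinRoot.root F := by simp [θ]
    have hθB : ∀ l, θ (Teissier.binomial n c A mu l) = 0 := by
      intro l
      by_cases hl : l = i
      · subst hl
        rw [hBi, map_sub, map_pow, hθi, map_one]
        have : AdjoinRoot.mk F F = 0 := AdjoinRoot.mk_self
        simpa [F, AdjoinRoot.mk_X] using this
      · have hnl : n l ≠ 0 := by have := hD.two_le l; omega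
        simp only [Teissier.binomial, map_sub, map_pow, map_mul, hθu l hl, zero_pow hnl,
          zero_sub, neg_eq_zero]
        -- the monomial `x^{A_l} u^{μ_l}` involves a variable killed by `θ`
        suffices hmon : θ (monomial ((A l).sumElim (mu l)) 1) = 0 by rw [hmon, mul_zero]
        by_contra hmon
        -- otherwise `A_l = 0` and `μ_l` is supported on `{i}`
        have hAl : A l = 0 := by
          ext j
          by_contra hj
          apply hmon
          rw [monomial_one_eq_X_pow_mul _ (Sum.inl j), map_mul, map_pow, hθx,
            zero_pow (by simpa using hj), zero_mul]
        have hmul : ∀ m, m ≠ i → mu l m = 0 := by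
          intro m hm
          by_contra hj
          apply hmon
          rw [monomial_one_eq_X_pow_mul _ (Sum.inr m), map_mul, map_pow, hθu m hm,
            zero_pow (by simpa using hj), zero_mul]
        -- then `v_l = 0`, so `l` is the first variable, i.e. `l = i`
        have hvl : v l = 0 := by
          have hhom := hD.homogeneous l
          have hwl : Teissier.weight v (A l) (mu l) = 0 := by
            funext j
            simp only [Teissier.weight, hAl, Finsupp.coe_zero, Pi.zero_apply, Nat.cast_zero,
              zero_add]
            refine Finset.sum_eq_zero fun m _ => ?_
            by_cases hm : m = i
            · subst hm; simp [hvi]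
            · simp [hmul m hm]
          rw [hwl] at hhom
          have hn : (n l : ℚ) ≠ 0 := by exact_mod_cast hnl
          funext j
          have := congrFun hhom j
          simp only [Pi.smul_apply, nsmul_eq_mul, Pi.zero_apply, mul_eq_zero] at this
          rcases this with h1 | h1
          · exact absurd h1 hn
          · exact h1
        exact hl (Fin.ext ((hfirst l hvl).trans hi0.symm))
    have hker : Teissier.binomialIdeal n c A mu ≤ RingHom.ker θ :=
      Ideal.span_le.2 (by rintro _ ⟨l, rfl⟩; exact hθB l)
    have hmem : (∑ m ∈ Finset.range N, X (Sum.inr i) ^ m) * (X (Sum.inr i) - 1) ∈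
        Teissier.binomialIdeal n c A mu := by
      rw [geom_sum_mul, ← hBi]
      exact Ideal.subset_span ⟨i, rfl⟩
    -- degrees in `𝔽₂[Y]`
    have hF0 : F ≠ 0 := by
      intro hF
      have := congrArg Polynomial.natDegree hF
      rw [Polynomial.natDegree_X_pow_sub_C, Polynomial.natDegree_zero] at this
      omega
    have hFdeg : F.natDegree = N := Polynomial.natDegree_X_pow_sub_C
    have hndvd : ∀ q : Polynomial (ZMod 2), q ≠ 0 → q.natDegree < N → ¬ F ∣ q := by
      intro q hq hdeg hdvd
      have := Polynomial.natDegree_le_of_dvd hdvd hq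
      omega
    rcases hD.isPrime.mem_or_mem hmem with h1 | h1
    · have h2 : θ (∑ m ∈ Finset.range N, X (Sum.inr i) ^ m) = 0 := hker h1
      rw [map_sum] at h2
      simp only [map_pow, hθi] at h2
      have h3 : AdjoinRoot.mk F (∑ m ∈ Finset.range N, Polynomial.X ^ m) = 0 := by
        rw [map_sum]; simpa [AdjoinRoot.mk_X] using h2
      rw [AdjoinRoot.mk_eq_zero] at h3
      refine hndvd _ ?_ ?_ h3
      · intro h0
        have := congrArg (Polynomial.coeff · 0) h0
        simp only [Polynomial.finsetSum_coeff, Polynomial.coeff_X_pow, Polynomial.coeff_zero]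
          at this
        rw [Finset.sum_ite_eq] at this
        simp only [Finset.mem_range] at this
        have h00 : 0 < N := by omega
        simp [h00] at this
      · refine lt_of_le_of_lt (Polynomial.natDegree_sum_le_of_forall_le _ _ (n := N - 1) ?_) ?_
        · intro m hm
          rw [Polynomial.natDegree_X_pow]
          have := Finset.mem_range.1 hm; omega
        · omega
    · have h2 : θ (X (Sum.inr i) - 1) = 0 := hker h1
      rw [map_sub, map_one, hθi] at h2
      have h3 : AdjoinRoot.mk F (Polynomial.X - Polynomial.C 1) = 0 := by
        simpa [AdjoinRoot.mk_X, AdjoinRoot.mk_C] using h2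
      rw [AdjoinRoot.mk_eq_zero] at h3
      refine hndvd _ (Polynomial.X_sub_C_ne_zero 1) ?_ h3
      rw [Polynomial.natDegree_X_sub_C]; omega
  · -- Case 1: the augmentation kills every equation
    push Not at hcase
    have hev : ∀ i, ev (Teissier.equation n c A mu h i) = 0 := by
      intro i
      have hc := hcore i
      rw [if_neg (fun hh' => hcase i hh'.1 hh'.2), neg_zero] at hc
      unfold Teissier.equation
      split_ifs with hi
      · rw [map_sub, hc, hev_apply]
        simp [MvPolynomial.coeff_X]
      · exact hc
    refine ⟨Ideal.Quotient.lift _ ev fun a ha => ?_⟩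
    have : Teissier.ideal n c A mu h ≤ RingHom.ker ev :=
      Ideal.span_le.2 (by rintro _ ⟨i, rfl⟩; exact hev i)
    exact this ha

/-! ## §2 Local rings: units versus `𝔽₂`-points, minimal primes of the completion -/

/-- A ring with an element `w` such that `w` and `w - 1` are both units has no ring homomorphism
to `𝔽₂`. [folklore] -/
theorem false_of_ringHom_zmod2 {O : Type*} [CommRing O] (χ : O →+* ZMod 2) {w : O}
    (hw : IsUnit w) (hw1 : IsUnit (w - 1)) : False := by
  have h1 := hw.map χ
  have h2 := hw1.map χ
  rw [map_sub, map_one] at h2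
  rw [isUnit_iff_ne_zero] at h1 h2
  revert h1 h2
  generalize χ w = a
  revert a
  decide

/-- In a Jacobson domain a nonzero element lies outside some maximal ideal (the Jacobson radical
is the nilradical, which is zero). [folklore] -/
theorem exists_isMaximal_not_mem {R : Type*} [CommRing R] [IsDomain R] [IsJacobsonRing R]
    {F : R} (hF : F ≠ 0) : ∃ M : Ideal R, M.IsMaximal ∧ F ∉ M := by
  by_contra hall
  push Not at hall
  have hmem : F ∈ (⊥ : Ideal R).jacobson := by
    rw [Ideal.jacobson, Ideal.mem_sInf]
    rintro J ⟨-, hJ⟩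
    exact hall J hJ
  rw [← Ideal.radical_eq_jacobson] at hmem
  have hnil : F ∈ nilradical R := hmem
  rw [nilradical_eq_zero, Ideal.zero_eq_bot, Ideal.mem_bot] at hnil
  exact hF hnil

/-- If `ρ : X' → P` restricts to an isomorphism over the open `U ∋ t`, `t` closed, then the point
of `X'` over `t` is closed and the stalk map transports a pair of units `w, w − 1`. [folklore] -/
theorem exists_closed_point_of_isIso_restrict {X' P : Scheme.{u}} (ρ : X' ⟶ P) (U : P.Opens)
    [IsIso (ρ ∣_ U)] (t : P) (ht : t ∈ U) (htc : IsClosed ({t} : Set P))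
    (hw : ∃ w : P.presheaf.stalk t, IsUnit w ∧ IsUnit (w - 1)) :
    ∃ x : X', IsClosed ({x} : Set X') ∧
      ∃ w : X'.presheaf.stalk x, IsUnit w ∧ IsUnit (w - 1) := by
  have hbij := (Scheme.homeoOfIso (asIso (ρ ∣_ U))).bijective
  rw [Scheme.coe_homeoOfIso, asIso_hom, morphismRestrict_base] at hbij
  obtain ⟨⟨x, hxU⟩, hx⟩ := hbij.2 ⟨t, ht⟩
  have hxt : ρ.base x = t := congrArg Subtype.val hx
  subst hxt
  refine ⟨x, ?_, ?_⟩
  · have : ({x} : Set X') = ρ.base ⁻¹' {ρ.base x} := by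
      ext y
      simp only [Set.mem_singleton_iff, Set.mem_preimage]
      constructor
      · rintro rfl; rfl
      · intro hy
        have hyU : y ∈ ρ ⁻¹ᵁ U := by
          show ρ.base y ∈ U
          rw [hy]; exact ht
        have := hbij.1 (a₁ := ⟨y, hyU⟩) (a₂ := ⟨x, hxU⟩) (Subtype.ext (by simpa using hy))
        exact congrArg Subtype.val this
    rw [this]
    exact htc.preimage ρ.continuous
  · obtain ⟨w, hw, hw1⟩ := hw
    refine ⟨(ρ.stalkMap x).hom w, hw.map _, ?_⟩
    rw [← map_one (ρ.stalkMap x).hom, ← map_sub]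
    exact hw1.map _

/-- The adic completion of a local ring at its maximal ideal is not the zero ring (it surjects
onto the residue field). [folklore] -/
theorem nontrivial_adicCompletion (O : Type*) [CommRing O] [IsLocalRing O] :
    Nontrivial (AdicCompletion (maximalIdeal O) O) := by
  haveI : Nontrivial (O ⧸ (maximalIdeal O) ^ 1) :=
    Ideal.Quotient.nontrivial_iff.2 (by rw [pow_one]; exact (maximalIdeal.isMaximal O).ne_top)
  exact (AdicCompletion.evalₐ (maximalIdeal O) 1).toRingHom.domain_nontrivial

/-- The completed local ring `𝒪̂` of a local ring has a minimal prime. [folklore] -/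
theorem exists_mem_minimalPrimes (O : Type*) [CommRing O] [IsLocalRing O] :
    ∃ P, P ∈ minimalPrimes (AdicCompletion (maximalIdeal O) O) := by
  haveI := nontrivial_adicCompletion O
  obtain ⟨M, hM⟩ := Ideal.exists_maximal (AdicCompletion (maximalIdeal O) O)
  obtain ⟨P, hP, -⟩ := Ideal.exists_minimalPrimes_le (show (⊥ : Ideal _) ≤ M from bot_le)
  exact ⟨P, hP⟩


/-- **Closed points of a Teissier-presented scheme over `𝔽₂` are `𝔽₂`-rational** (in the weak
form used here): the local ring at a closed point maps to `𝔽₂`, through the completion, any of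
its branches and the augmentation of `exists_ringHom_of_isDatum`. [folklore] -/
theorem exists_ringHom_stalk_of_teissierPresented {X' : Scheme.{0}}
    (h : TeissierPresented (ZMod 2) X') (x : X') (hx : IsClosed ({x} : Set X')) :
    Nonempty (X'.presheaf.stalk x →+* ZMod 2) := by
  obtain ⟨S, g, π, -, -, -, -, -, -, -, hpt⟩ := h
  obtain ⟨P, hP⟩ := exists_mem_minimalPrimes (X'.presheaf.stalk x)
  obtain ⟨d, φ, ι, ⟨g', n, v, c, A, mu, hh, hD, ψ, -⟩, -⟩ := hpt x hx P hP
  obtain ⟨χ⟩ := exists_ringHom_of_isDatum hD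
  exact ⟨(χ.comp ψ.toRingHom).comp ((Ideal.Quotient.mk P).comp (algebraMap _ _))⟩

end Summit.ResolutionOfSingularities.ResolutionOfSingularities.Theorems.TeissierReduction.Negative

end
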